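import Mathlib
import Summits.Ventures.PercRepro2.CoinChainXAClosedGateAlg

/-!
# The CLOSED GATE of (XA′) for GENERAL markers — the algebra (blind cell PercRepro2, night-2 g30)

Markers that do not vanish on the entry-free ideal are handled by SHIFTING them by their ideal
means: the cleared (XA′) is invariant under `x ↦ x − κ`, the shifted ideal has no single-marker
mass, and the ideal's `xy`-mass becomes its covariance `a·XYI − XI·YI ≥ 0` (FKG on the ideal, a
sublattice).  In the `a`-scaled shifted variables `X̃J = a·XJ − XI·δ`, … the closed-gate functional
satisfies the identity `cg_gen_identity`: `a⁴·(a0·U001 − Cross) = a0³·a³·(a·XYI − XI·YI) + T̂` with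
`T̂` the PARTS functional of CoinChainXAClosedGateAlg.lean at the masses `(a², aδ, au, at)`.  The
parts inequality `cg_parts` needs the shifted killed masses `X̃J, ỸJ ≥ 0`; when one of them is
`≤ 0` the one-sided inequality `cg_parts_onesided` closes instead (the killed part is then
`x`-poorer than the ideal, its cross term is a gain, and the other cross term is at most the
ideal term by two Holley facts).
-/

namespace Summit.Ventures.PercRepro2.Coin

section ClosedGateGenAlg

variable {R : Type*} [Field R] [LinearOrder R] [IsStrictOrderedRing R]

/-- **The one-sided parts inequality** (`XJ ≤ 0`): the cross term of the killed part's `x`-shift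
is a gain, and the other cross term is at most `a·L·Px·Py`. -/
theorem cg_parts_onesided (a δ u t XJ XU XM YJ YU YM : R)
    (ha : 0 ≤ a) (hδ : 0 ≤ δ) (hu : 0 ≤ u) (ht : 0 ≤ t)
    (hXJ : XJ ≤ 0) (hXJU : 0 ≤ XJ + XU) (hXM : 0 ≤ XM) (hYJU : 0 ≤ YJ + YU) (hYM : 0 ≤ YM)
    (hJUy : 0 ≤ YU * (a + δ) - YJ * u) (hJMy : 0 ≤ YM * (a + δ) - YJ * t)
    (hMcMx : 0 ≤ XM * (a + δ + u) - (XJ + XU) * t)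
    (hMcMy : 0 ≤ YM * (a + δ + u) - (YJ + YU) * t) :
    0 ≤ a * (a + δ + u + t) * (XJ + XU + XM) * (YJ + YU + YM)
        - (XJ * (a + δ + u + t) - δ * (XJ + XU + XM)) * (YM * (a + δ + u + t) - t * (YJ + YU + YM))
        - (YJ * (a + δ + u + t) - δ * (YJ + YU + YM)) * (XM * (a + δ + u + t) - t * (XJ + XU + XM)) := by
  have hL : 0 ≤ a + δ + u + t := by linarith
  have hPx : 0 ≤ XJ + XU + XM := by linarith
  have hPy : 0 ≤ YJ + YU + YM := by linarith
  -- (1) the x-cross term is a gain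
  have hQx : XJ * (a + δ + u + t) - δ * (XJ + XU + XM) ≤ 0 := by
    nlinarith [mul_nonneg hδ hPx, mul_nonneg (neg_nonneg.2 hXJ) hL]
  have hBy : 0 ≤ YM * (a + δ + u + t) - t * (YJ + YU + YM) := by linear_combination hMcMy
  have h1 : 0 ≤ - (XJ * (a + δ + u + t) - δ * (XJ + XU + XM)) * (YM * (a + δ + u + t) - t * (YJ + YU + YM)) :=
    mul_nonneg (neg_nonneg.2 hQx) hBy
  -- (2) the y-cross term is at most the ideal term
  have hQy : YJ * (a + δ + u + t) - δ * (YJ + YU + YM) ≤ a * (YJ + YU + YM) := by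
    linear_combination hJUy + hJMy
  have hBx : 0 ≤ XM * (a + δ + u + t) - t * (XJ + XU + XM) := by linear_combination hMcMx
  have hBxL : XM * (a + δ + u + t) - t * (XJ + XU + XM) ≤ (a + δ + u + t) * (XJ + XU + XM) := by
    nlinarith [mul_nonneg (add_nonneg hL ht) hXJU, mul_nonneg ht hXM]
  have h2 : (YJ * (a + δ + u + t) - δ * (YJ + YU + YM)) * (XM * (a + δ + u + t) - t * (XJ + XU + XM)) ≤
      a * (YJ + YU + YM) * ((a + δ + u + t) * (XJ + XU + XM)) := by
    calc (YJ * (a + δ + u + t) - δ * (YJ + YU + YM)) * (XM * (a + δ + u + t) - t * (XJ + XU + XM))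
        ≤ a * (YJ + YU + YM) * (XM * (a + δ + u + t) - t * (XJ + XU + XM)) :=
          mul_le_mul_of_nonneg_right hQy hBx
      _ ≤ a * (YJ + YU + YM) * ((a + δ + u + t) * (XJ + XU + XM)) :=
          mul_le_mul_of_nonneg_left hBxL (mul_nonneg ha hPy)
  nlinarith [h1, h2]

omit [LinearOrder R] [IsStrictOrderedRing R] in
/-- The `a`-scaled ideal-shift identity: the closed-gate functional of GENERAL markers in terms of
the thirteen part masses (`XI, YI, XYI` the ideal's marker masses) equals the ideal's FKG
covariance plus the parts functional at the scaled shifted variables. -/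
theorem cg_gen_identity (a δ u t XI XJ XU XM YI YJ YU YM XYI : R) :
    a ^ 4 * ((a + δ + u + t) *
        ((a + δ + u + t) * (a + δ + u + t) * XYI
          - (a + δ + u + t) * (YI + YJ + YU + YM) * XI
          - (a + δ + u + t) * (XI + XJ + XU + XM) * YI
          + (XI + XJ + XU + XM) * (YI + YJ + YU + YM) * a)
      - (((a + δ + u + t) * (XI + XU + XM) - (XI + XJ + XU + XM) * (a + u + t)) *
          ((a + δ + u + t) * (YI + YJ + YU) - (YI + YJ + YU + YM) * (a + δ + u))
        + ((a + δ + u + t) * (YI + YU + YM) - (YI + YJ + YU + YM) * (a + u + t)) *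
          ((a + δ + u + t) * (XI + XJ + XU) - (XI + XJ + XU + XM) * (a + δ + u)))) =
    (a + δ + u + t) ^ 3 * a ^ 3 * (a * XYI - XI * YI)
      + ((a * a) * (a * a + a * δ + a * u + a * t) * ((a * XJ - XI * δ) + (a * XU - XI * u) + (a * XM - XI * t))
          * ((a * YJ - YI * δ) + (a * YU - YI * u) + (a * YM - YI * t))
        - ((a * XJ - XI * δ) * (a * a + a * δ + a * u + a * t) - (a * δ) * ((a * XJ - XI * δ) + (a * XU - XI * u) + (a * XM - XI * t)))
          * ((a * YM - YI * t) * (a * a + a * δ + a * u + a * t) - (a * t) * ((a * YJ - YI * δ) + (a * YU - YI * u) + (a * YM - YI * t)))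
        - ((a * YJ - YI * δ) * (a * a + a * δ + a * u + a * t) - (a * δ) * ((a * YJ - YI * δ) + (a * YU - YI * u) + (a * YM - YI * t)))
          * ((a * XM - XI * t) * (a * a + a * δ + a * u + a * t) - (a * t) * ((a * XJ - XI * δ) + (a * XU - XI * u) + (a * XM - XI * t)))) := by
  ring

end ClosedGateGenAlg

end Summit.Ventures.PercRepro2.Coin
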